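import Summits.QuantumAdvantage.QuantumAdvantage.Theorems.LinnikCubicClassGroupsDegreeOnePrimesEscapeChebotarevDivision
import HarnessLib

/-!
# The Chebotarev–Linnik theorem for Frobenius divisions: corollaries

Topic `Summits/QuantumAdvantage/QuantumAdvantage/Theorems`, cell B2b-1 (linnik-cubic), PART A (gen 9);
helper toward the crux `DegreeOnePrimesEscape` (stmt-QuantumAdvantage-11543) of route
`LinnikCubicClassGroups`.  HONEST FRAMING: the value of this file is a THEOREM (kernel-checked, GRH-free,
Siegel-free, no hypothesis) — NOT summit progress.

Reformulations of `exists_frobenius_generates_le` (moving to a conjugate prime with `IsArithFrobAt.conj`):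

* `exists_frobenius_zpowers_eq_le` — for `N` Galois of degree `n > 1` and `σ ∈ Gal(N/ℚ)`: a prime
  `p ≤ |d_N|^{L(n)}`, `p ∤ d_N`, and a prime `Q ∣ p` of `N` with trivial inertia whose arithmetic Frobenius
  `φ` GENERATES `⟨σ⟩` (`⟨φ⟩ = ⟨σ⟩`, no conjugation);
* `exists_isArithFrobAt_le_of_division` — if every generator of `⟨σ⟩` is conjugate to `σ` (the class of
  `σ` is a whole division; e.g. every element of a symmetric group, every element of order `≤ 2`, every
  "real" element of order `3, 4, 6`), then `σ` ITSELF is the arithmetic Frobenius at some prime `Q ∣ p` of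
  `N`, `p ≤ |d_N|^{L(n)}`, `p ∤ d_N` — Lagarias–Montgomery–Odlyzko's theorem for such classes;
* `exists_isArithFrobAt_le_of_orderOf_le_two` — in particular for every `σ` with `σ² = 1`.

References: J. C. Lagarias, H. L. Montgomery, A. M. Odlyzko, Invent. Math. 54 (1979), Thm. 1.1
[LagariasMontgomeryOdlyzko1979].
-/

noncomputable section

open scoped NumberField nonZeroDivisors Pointwise
open Finset Real Ideal NumberField
open Literature.NumberTheory.NumberFields Literature.NumberTheory.LFunctions
  Literature.NumberTheory.LFunctions.NumberField

namespace Summit.QuantumAdvantage.QuantumAdvantage.Theorems.DegreeOnePrimesEscape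

section Transport

variable {N : Type} [Field N] [NumberField N] [IsGalois ℚ N]

/-- **Transport of a Frobenius to a conjugate prime**: if `φ` is an arithmetic Frobenius at a prime
`Q ∣ p` of `N` with trivial inertia, then `g φ g⁻¹` is one at `g • Q ∣ p`, again maximal with trivial
inertia. -/
theorem frobenius_transport {p : ℕ} (hp : p.Prime) (Q : Ideal (𝓞 N)) [hQ : Q.IsMaximal]
    [hQp : Q.LiesOver (span {(p : ℤ)})] {φ : N ≃ₐ[ℚ] N} (hφ : IsArithFrobAt ℤ φ Q)
    (hI : Q.inertia (N ≃ₐ[ℚ] N) = ⊥) (g : N ≃ₐ[ℚ] N) :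
    ∃ (_ : (g • Q).IsMaximal) (_ : (g • Q).LiesOver (span {(p : ℤ)})),
      IsArithFrobAt ℤ (g * φ * g⁻¹) (g • Q) ∧ (g • Q).inertia (N ≃ₐ[ℚ] N) = ⊥ := by
  classical
  haveI := Fact.mk hp
  haveI h𝔭max : (span {(p : ℤ)}).IsMaximal := Int.ideal_span_isMaximal_of_prime p
  have hp𝔭 : (span {(p : ℤ)}) ≠ ⊥ := by
    rw [Ne, span_singleton_eq_bot]; exact_mod_cast hp.ne_zero
  haveI : IsGaloisGroup (N ≃ₐ[ℚ] N) ℤ (𝓞 N) := IsGaloisGroup.of_isFractionRing _ _ _ ℚ N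
  haveI hQ'p : (g • Q).LiesOver (span {(p : ℤ)}) := inferInstance
  have hQ'prime : (g • Q).IsPrime := inferInstance
  haveI hQ'max : (g • Q).IsMaximal :=
    hQ'prime.isMaximal (Ideal.ne_bot_of_liesOver_of_ne_bot hp𝔭 _)
  refine ⟨hQ'max, hQ'p, hφ.conj g, ?_⟩
  -- the inertia groups of `Q` and `g • Q` have the same order `e(p)`
  apply Subgroup.eq_bot_of_card_eq
  have h1 := Ideal.card_inertia_eq_ramificationIdxIn (G := N ≃ₐ[ℚ] N) (span {(p : ℤ)}) (g • Q)
  have h2 := Ideal.card_inertia_eq_ramificationIdxIn (G := N ≃ₐ[ℚ] N) (span {(p : ℤ)}) Q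
  rw [h1, ← h2, hI, Subgroup.card_bot]

end Transport

/-- **A Frobenius generating `⟨σ⟩` below `|d_N|^L`**: for `n > 1` there is `L > 0` such that for every
Galois number field `N` of degree `n` and every `σ ∈ Gal(N/ℚ)` there are a prime `p ≤ |d_N|^L`,
`p ∤ d_N`, and a prime `Q ∣ p` of `N` with trivial inertia whose arithmetic Frobenius `φ` satisfies
`⟨φ⟩ = ⟨σ⟩`. [cite: LagariasMontgomeryOdlyzko1979, Theorem 1.1] -/
theorem exists_frobenius_zpowers_eq_le (n : ℕ) (hn : 1 < n) :
    ∃ L : ℝ, 0 < L ∧ ∀ (N : Type) [Field N] [NumberField N] [IsGalois ℚ N],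
      Module.finrank ℚ N = n → ∀ σ : N ≃ₐ[ℚ] N,
        ∃ p : ℕ, p.Prime ∧ (p : ℝ) ≤ ((NumberField.discr N).natAbs : ℝ) ^ L ∧
          ¬ ((p : ℤ) ∣ NumberField.discr N) ∧
          ∃ (Q : Ideal (𝓞 N)) (_ : Q.IsMaximal) (_ : Q.LiesOver (span {(p : ℤ)})) (φ : N ≃ₐ[ℚ] N),
            IsArithFrobAt ℤ φ Q ∧ Q.inertia (N ≃ₐ[ℚ] N) = ⊥ ∧
              Subgroup.zpowers φ = Subgroup.zpowers σ := by
  obtain ⟨L, hL, h⟩ := exists_frobenius_generates_le n hn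
  refine ⟨L, hL, fun N _ _ _ hN σ => ?_⟩
  obtain ⟨p, hp, hpx, hpN, Q, hQmax, hQover, φ, g, hφ, hI, hg⟩ := h N hN σ
  obtain ⟨hQ'max, hQ'over, hφ', hI'⟩ := frobenius_transport hp Q hφ hI g
  exact ⟨p, hp, hpx, hpN, g • Q, hQ'max, hQ'over, g * φ * g⁻¹, hφ', hI', hg⟩

/-- **Lagarias–Montgomery–Odlyzko for the classes that are divisions**: if every generator of `⟨σ⟩` is
conjugate to `σ` in `Gal(N/ℚ)`, then `σ` itself is the arithmetic Frobenius at some prime `Q ∣ p` of `N`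
with trivial inertia, `p ≤ |d_N|^{L(n)}`, `p ∤ d_N`.  (This hypothesis holds for every element of a
symmetric group and for every involution.) [cite: LagariasMontgomeryOdlyzko1979, Theorem 1.1] -/
theorem exists_isArithFrobAt_le_of_division (n : ℕ) (hn : 1 < n) :
    ∃ L : ℝ, 0 < L ∧ ∀ (N : Type) [Field N] [NumberField N] [IsGalois ℚ N],
      Module.finrank ℚ N = n → ∀ σ : N ≃ₐ[ℚ] N,
        (∀ τ : N ≃ₐ[ℚ] N, Subgroup.zpowers τ = Subgroup.zpowers σ → IsConj τ σ) →
        ∃ p : ℕ, p.Prime ∧ (p : ℝ) ≤ ((NumberField.discr N).natAbs : ℝ) ^ L ∧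
          ¬ ((p : ℤ) ∣ NumberField.discr N) ∧
          ∃ (Q : Ideal (𝓞 N)) (_ : Q.IsMaximal) (_ : Q.LiesOver (span {(p : ℤ)})),
            IsArithFrobAt ℤ σ Q ∧ Q.inertia (N ≃ₐ[ℚ] N) = ⊥ := by
  obtain ⟨L, hL, h⟩ := exists_frobenius_zpowers_eq_le n hn
  refine ⟨L, hL, fun N _ _ _ hN σ hdiv => ?_⟩
  obtain ⟨p, hp, hpx, hpN, Q, hQmax, hQover, φ, hφ, hI, hφσ⟩ := h N hN σ
  obtain ⟨c, hc⟩ := isConj_iff.mp (hdiv φ hφσ)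
  obtain ⟨hQ'max, hQ'over, hφ', hI'⟩ := frobenius_transport hp Q hφ hI c
  rw [hc] at hφ'
  exact ⟨p, hp, hpx, hpN, c • Q, hQ'max, hQ'over, hφ', hI'⟩

/-- For `σ` of order `≤ 2` the only generator of `⟨σ⟩` is `σ`. -/
theorem isConj_of_zpowers_eq_of_orderOf_le_two {G : Type*} [Group G] [Finite G] {σ τ : G}
    (hσ : orderOf σ ≤ 2) (h : Subgroup.zpowers τ = Subgroup.zpowers σ) : IsConj τ σ := by
  have hτ : τ ∈ Subgroup.zpowers σ := h ▸ Subgroup.mem_zpowers τ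
  have hord : orderOf τ = orderOf σ := by rw [← Nat.card_zpowers, ← Nat.card_zpowers, h]
  obtain ⟨j, hj⟩ := ((isOfFinOrder_of_finite σ).mem_powers_iff_mem_zpowers).mpr hτ
  have hj' : σ ^ j = τ := hj
  rcases Nat.lt_or_ge (orderOf σ) 2 with h1 | h2
  · have h1' : orderOf σ = 1 := by have := orderOf_pos σ; omega
    have hσ1 : σ = 1 := orderOf_eq_one_iff.mp h1'
    have hτ1 : τ = 1 := orderOf_eq_one_iff.mp (hord.trans h1')
    rw [hσ1, hτ1]
  · have h2' : orderOf σ = 2 := le_antisymm hσ h2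
    rcases Nat.mod_two_eq_zero_or_one j with h0 | h1
    · exfalso
      rw [← hj', ← pow_mod_orderOf, h2', h0, pow_zero, orderOf_one] at hord
      omega
    · rw [← hj', ← pow_mod_orderOf, h2', h1, pow_one]

/-- **Involutions**: for every `σ ∈ Gal(N/ℚ)` with `σ² = 1` (and `σ = 1`) there are a prime
`p ≤ |d_N|^{L(n)}`, `p ∤ d_N`, and a prime `Q ∣ p` of `N` with trivial inertia at which `σ` is the
arithmetic Frobenius. [cite: LagariasMontgomeryOdlyzko1979, Theorem 1.1] -/
theorem exists_isArithFrobAt_le_of_orderOf_le_two (n : ℕ) (hn : 1 < n) :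
    ∃ L : ℝ, 0 < L ∧ ∀ (N : Type) [Field N] [NumberField N] [IsGalois ℚ N],
      Module.finrank ℚ N = n → ∀ σ : N ≃ₐ[ℚ] N, orderOf σ ≤ 2 →
        ∃ p : ℕ, p.Prime ∧ (p : ℝ) ≤ ((NumberField.discr N).natAbs : ℝ) ^ L ∧
          ¬ ((p : ℤ) ∣ NumberField.discr N) ∧
          ∃ (Q : Ideal (𝓞 N)) (_ : Q.IsMaximal) (_ : Q.LiesOver (span {(p : ℤ)})),
            IsArithFrobAt ℤ σ Q ∧ Q.inertia (N ≃ₐ[ℚ] N) = ⊥ := by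
  obtain ⟨L, hL, h⟩ := exists_isArithFrobAt_le_of_division n hn
  refine ⟨L, hL, fun N _ _ _ hN σ hσ => h N hN σ fun τ hτ => ?_⟩
  exact isConj_of_zpowers_eq_of_orderOf_le_two hσ hτ

end Summit.QuantumAdvantage.QuantumAdvantage.Theorems.DegreeOnePrimesEscape

end
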